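import Mathlib
import Summits.KontsevichZagierPeriods.Zeta5Search.TSOriginDataO62
import Summits.KontsevichZagierPeriods.Zeta5Search.TypeSpaceWindows
import Summits.KontsevichZagierPeriods.Zeta5Search.AtlasRayRecord
import Summits.KontsevichZagierPeriods.Zeta5Search.CellKitCentre
import Summits.KontsevichZagierPeriods.Zeta5Search.TSWindowZ64P1
import Summits.KontsevichZagierPeriods.Zeta5Search.TSWindowO62P1
import Summits.KontsevichZagierPeriods.Zeta5Search.TSWindowO62P2
import Summits.KontsevichZagierPeriods.Zeta5Search.TSWindowO62P3
import Summits.KontsevichZagierPeriods.Zeta5Search.TSWindowO62P4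
import Summits.KontsevichZagierPeriods.Zeta5Search.TSWindowO62P5
import Summits.KontsevichZagierPeriods.Zeta5Search.TSWindowO62P6
import Summits.KontsevichZagierPeriods.Zeta5Search.TSWindowO62P7
import Summits.KontsevichZagierPeriods.Zeta5Search.TSWindowO62P8
import Summits.KontsevichZagierPeriods.Zeta5Search.TSWindowO62P9
import Summits.KontsevichZagierPeriods.Zeta5Search.TSWindowO62P10
import Summits.KontsevichZagierPeriods.Zeta5Search.TSWindowO62P11
import Summits.KontsevichZagierPeriods.Zeta5Search.TSWindowO62P12
import Summits.KontsevichZagierPeriods.Zeta5Search.TSWindowO62P13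
import Summits.KontsevichZagierPeriods.Zeta5Search.TSWindowO62P14
import Summits.KontsevichZagierPeriods.Zeta5Search.TSWindowO62P15
import Summits.KontsevichZagierPeriods.Zeta5Search.TSWindowO62P16
import Summits.KontsevichZagierPeriods.Zeta5Search.TSWindowO62P17
import Summits.KontsevichZagierPeriods.Zeta5Search.TSWindowO62P18
import Summits.KontsevichZagierPeriods.Zeta5Search.TSWindowO62P19
import HarnessLib

/-!
# ζ(5) search — type-space (origin regime; θ < 2) record window `M = 62` of `TypeSpaceWindows.lean`: `RecTSClassesO62` (part 20/20) (HONEST FRAMING: systematic search; no irrationality claim unless certified)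

Cell `pub-zeta5`, prover seat p3 generation 3.  MACHINE-GENERATED by `code/gen/zwgen.py` (p3 g3) in the format of P1's atlas machine
(`AtlasCellRec*`): exact scale-free class analysis of the record ray `bRec n = bLin (11n) (7n) n` on the window `14 * n < 17 * p`, `6 * p ≤ 5 * n`
(all odd `p`, all `n ≤ 300`: 234 instances; class lengths `[49, 50]`, bracket signatures per length `{49: 10, 50: 12}`), every statement then
PROVED (`omega` leaf by leaf).  Bracket classification generated afresh (one LEAF theorem per signature, decision tree inline in `zw_L*`).
Target: the `@[conjecture]` node `OriginWindows.RecOriginClassesM62` of `OriginWindowData.lean` (deep types `D62`, sub-deep `S62`,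
odd-centre `P62`) and hence `ResidueLaw.RecWindowM62` by the reduction `OriginWindows.recWindowM62_of` (line data PROVED there).  Integer bookkeeping (`netExp` along residue classes);
valuations of rationals; nothing here bears on irrationality.
-/

open Finset

namespace Summit.KontsevichZagierPeriods.Zeta5Search.TSWindowO62

open Summit.KontsevichZagierPeriods.Zeta5Search.ClusterValuation (netExp classSet CentreIn classExp conjClass bRec classPoleCount)
open Summit.KontsevichZagierPeriods.Zeta5Search.CasoratianValuation (InPolytope shift casoratian)
open Summit.KontsevichZagierPeriods.Zeta5Search.CellKit
open Summit.KontsevichZagierPeriods.Zeta5Search.SecondOrder (classTypeList isRaise classTypeList_level)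
open Summit.KontsevichZagierPeriods.Zeta5Search.AtlasRayRecord
open Summit.KontsevichZagierPeriods.Zeta5Search.ResidueLaw (RecTSClassesO62 RecWindowTSM62 recWindowTSM62_of typeSpaceLawOrigin_holds dirDet)
open Summit.KontsevichZagierPeriods.Zeta5Search.OriginWindows

variable {p : ℕ} [hp : Fact p.Prime]

/-- **Class structure of the window** (`14 * n < 17 * p`, `6 * p ≤ 5 * n`, every instance): `OriginWindowClassesC (bRec n) p 62 D62 S62 P62 C62`. -/
theorem originClasses (n p : ℕ) (_hn : 2 ≤ n) (hprime : p.Prime) (h1 : 14 * n < 17 * p) (h2 : 6 * p ≤ 5 * n) :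
    OriginWindowClassesC (bRec n) p 62 D62 S62 P62 C62 := by
  haveI : Fact p.Prime := ⟨hprime⟩
  have hp2 : p % 2 = 1 := Nat.odd_iff.1 (hprime.odd_of_ne_two (by omega))
  rw [bRec_eq_bLin]
  unfold OriginWindowClassesC
  refine ⟨fun x hx _ => ?_, fun x hx _ hE => ?_, fun x hx _ hE => ?_⟩
  · rcases Nat.lt_or_ge (41 * n) (x + 49 * p) with hL49 | hL49
    · have h := (zw_L48 h1 h2 hp2 hx (by omega) (by omega)).1
      omega
    · have h := (zw_L49 h1 h2 hp2 hx (by omega) (by omega)).1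
      omega
  · rcases Nat.lt_or_ge (41 * n) (x + 49 * p) with hL49 | hL49
    · exact (zw_L48 h1 h2 hp2 hx (by omega) (by omega)).2.1 (by omega)
    · exact (zw_L49 h1 h2 hp2 hx (by omega) (by omega)).2.1 (by omega)
  · rcases Nat.lt_or_ge (41 * n) (x + 49 * p) with hL49 | hL49
    · exact (zw_L48 h1 h2 hp2 hx (by omega) (by omega)).2.2 (by omega)
    · exact (zw_L49 h1 h2 hp2 hx (by omega) (by omega)).2.2 (by omega)

/-- **`ResidueLaw.RecTSClassesO62` IS A THEOREM** (bookkeeping of the origin type-space window `M = 62`): class structure `originClasses` +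
PROVED line data `lineData62` ⇒ (G1), `u62 ≢ 0`, deep orbit vectors `∥ u62` (`OriginWindows.deep_dir`), and `dirDet = 0` EXACTLY for all live
pairs (`OriginWindows.lineVal_live`). -/
theorem recTSClassesO62_holds : RecTSClassesO62 := by
  intro n p hn hprime h1 h2 _hsq _hdr
  haveI : Fact p.Prime := ⟨hprime⟩
  have hC := originClasses n p hn hprime h1 h2
  have hpn : (p : ℤ) ≤ bRec n 0 := by
    rw [show bRec n 0 = 41 * (n : ℤ) by simp [bRec, mul_comm]]; exact_mod_cast (show p ≤ 41 * n by omega)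
  have hb := ClusterValuation.inPolytope_bRec n
  refine ⟨hC.1, u62, u62_ne hprime, fun x hx hpole hE => ⟨(hC.2.1 x hx hpole hE).1, dirEq_of_classesC (bRec n) hb hpn hC lineData62 hx hpole hE⟩,
    fun x hx y hy => Or.inl ?_⟩
  have ex := lineVal_liveC (bRec n) hb hpn (by norm_num : 6 ≤ 62) hC lineData62 hx
  have ey := lineVal_liveC (bRec n) hb hpn (by norm_num : 6 ≤ 62) hC lineData62 hy
  simp only [lineVal] at ex ey
  unfold dirDet
  linarith
/-- **`ResidueLaw.RecWindowTSM62` IS A THEOREM**: `v_p(Cas₇(b(n))) ≥ -119` on the window (gen-2 g13's reduction `recWindowTSM62_of`, p3 g2's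
`typeSpaceLawOrigin_holds`). -/
theorem recWindowTSM62_holds : RecWindowTSM62 := recWindowTSM62_of typeSpaceLawOrigin_holds recTSClassesO62_holds

end Summit.KontsevichZagierPeriods.Zeta5Search.TSWindowO62
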